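import Summits.QuantumFields.YangMills.Theorems.UnitScaleTiltFluctuationComparisonRegPrGlobalSlackLegNaturalRowsTwoRunDoorSelLocal
import Summits.QuantumFields.YangMills.Theorems.UnitScaleTiltFluctuationComparisonRegPrGlobalSlackKernelLegAnchorCoherent
import HarnessLib

/-!
# `UnitScaleTiltFluctuationComparisonRegPrGlobalSlackLegNaturalRowsTwoRunDoorSelCoherent` — THE NATURAL-OBJECT DOOR OF 3⁗χ(v4) AT A RUN-COHERENT ANCHOR: (BC) TRADED FOR ITS SUPPLIER ROWS
# (New) + (Lip♮) + (Fine_b) (crux `FluctuationComparisonRegPrIntL`, stmt-QuantumFields-20520, skeleton v5kD, STUB 3⁗χ(v4) `stub_globalTwoRunSlackFamChiV4`; LEAD ym-ust-20520-w2 g5, (B8) of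
# ★★OWNER ACK 50 (4)/51 (2) «GO-(B)»; count-neutral helper, def-free, registry untouched)

WHY.  ✓`k1aLegRowsDisplayTwoRunChiAtV4_of_kernelRowsSel_of_loc_ker` (`…NaturalRowsTwoRunDoorSelLocal`, this seat) leaves, at the natural objects with a selected anchor, the residue
(43)-as-definition + p.263 L4 locality + (43) kernel budget + the two one-family two-run rows (K)[Φ♮] and (BC)[B♮[sel]].  ym-inputs-p12 g6's ✓`…KernelLegAnchorCoherent` shows that at a
RUN-COHERENT selector the configuration row (BC) follows from (New) (the record's `Bcfg` two-run row at the new chart level — B0's coherence), (Lip♮) (Lipschitz of the old-level loop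
variable between the two fine backgrounds; the T³ supplier is ✓p632814 §4) and (Fine_b) (the two fine backgrounds are close — the UNPRINTED configuration estimate of non-abelian
`d = 3`): ✓`cfgDistCauchyΦ_naturalCoherent_of_newLevel_of_fine`.  THIS FILE composes the two:

* ★★★★ **`k1aLegRowsDisplayTwoRunChiAtV4_of_kernelRowsSel_of_loc_ker_of_newLevel_fine`** (`1 < L < 𝔠.M₁`, `p₁ ≥ p₀ + r₀`; `hsel` membership, `hcoh` coherence of the selector):
  display ⇐ ∃ `κ′ R C C_A(≥ C25+C63) b(≥ 2, ≥ a+1) L_Φ C_f C_N γB`, ∀ F γ ≤ γB, `OfV4ChiAt` → ∃ p coherent, ∃ N: (43) · (K)[Φ♮] · (ℓ) · (k) · ∃ δ: (New) · (Lip♮) · (Fine_b).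

HONEST SCOPE.  A composition of landed reductions; every listed row is a HYPOTHESIS, not asserted; nothing of [Balaban1985UV3] / [King1986] is asserted; no stub / crux / registry object
touched (`--supports stmt-QuantumFields-20520`); no summit / rung / gap claim (YM₃ on T³ is ladder rung R3, not the Clay problem).  L-floor: none beyond `1 < L`; `L < M₁` is print's
big-block letter.

References: T. Bałaban, CMP 102 (1985) 255–275 [Balaban1985UV3] (p.263 L4, (24)–(25) p.262, (27)–(30) p.263, (33)–(34) p.264, (43)–(45) pp.266–267, (59)–(63) pp.270–272); C. King,
CMP 102 (1986) 649–677 [King1986] (Thm 3.4 (3.9) p.656, Prop. 3.6 (3.56) p.662, Prop. 3.9 (3.71)–(3.74) p.665); CMP 109 (1987) 249–301 [Balaban1987RG1] ((0.1) p.251).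
-/

set_option autoImplicit false

noncomputable section

open scoped Matrix.Norms.L2Operator Nat
open Literature.MathematicalPhysics.QuantumFieldTheory.Balaban1983to89
open Literature.MathematicalPhysics.QuantumFieldTheory.Balaban1983to89.T3ContinuumYM3Torus
open Literature.MathematicalPhysics.QuantumFieldTheory.Balaban1983to89.T3UnitLawDensityEML (ℰp)
open Literature.MathematicalPhysics.QuantumFieldTheory.Balaban1983to89.T3UnitScaleTilt (θBal)
open Literature.MathematicalPhysics.QuantumFieldTheory.Balaban1983to89.T3LevelShift (fieldShift)
open Literature.MathematicalPhysics.QuantumFieldTheory.Balaban1983to89.T3AlphaInputsAC (AlphaDataT3)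
open Literature.MathematicalPhysics.QuantumFieldTheory.Balaban1983to89.T3AlphaPolymerSocket (refineSet)
open Literature.MathematicalPhysics.QuantumFieldTheory.Balaban1983to89.TreeLengthTorus (tsys)
open Literature.MathematicalPhysics.QuantumFieldTheory.Balaban1983to89.B10Eq27TorusAxialLog
open Literature.MathematicalPhysics.QuantumFieldTheory.Balaban1983to89.B7Prop1Explicit (l1)
open Literature.MathematicalPhysics.QuantumFieldTheory.Balaban1983to89.ExpMeanLog (deltaSU deltaSU_pos)
open Literature.MathematicalPhysics.QuantumFieldTheory.Balaban1985CMP102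
open Literature.MathematicalPhysics.QuantumFieldTheory.Balaban1985CMP102.Setting
open Literature.MathematicalPhysics.QuantumFieldTheory.Balaban1985CMP102.Binders (ChartAnalyticityAsCited)
open Summit.QuantumFields.Balaban3D.Carriers
open Summit.QuantumFields.Balaban3D.Proofs.Primitives
open Summit.QuantumFields.Balaban3D.Proofs.GroupModelLieC (vecE lieC)
open Summit.QuantumFields.YangMills.Theorems
open Summit.QuantumFields.YangMills.Theorems.GlobalSlackKernelMatching
open Summit.QuantumFields.YangMills.Theorems.GlobalSlackCanonicalPolymers

namespace Summit.QuantumFields.YangMills.Theorems.GlobalSlackKernelLeg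

variable (sel : (F : T3Family) → (K b : ℕ) → Set (Site (F.P K) 0) → Site (F.P K) b)
  (hsel : ∀ (F : T3Family) (K b : ℕ) (Y : Set (Site (F.P K) 0)), sel F K b Y ∈ anchors K b Y)

include hsel

/-! ## §1 The door at a run-coherent anchor -/

open Classical in
/-- ★★★★ **THE TWO-RUN DISPLAY OF 3⁗χ(v4) AT THE NATURAL OBJECTS WITH A RUN-COHERENT ANCHOR, THE CONFIGURATION TWO-RUN ROW (BC) TRADED FOR ITS THREE SUPPLIER ROWS**: for a selector
`sel F K b Y ∈ anchors K b Y` that is COHERENT along the refinement (`sel F (K+1) (b+1) (refineSet Y) = liftSite (sel F K b Y)`, ym-inputs-p12 g6's `exists_anchorSel_coherent`), the door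
✓`k1aLegRowsDisplayTwoRunChiAtV4_of_kernelRowsSel_of_loc_ker` with (BC)[B♮[sel F]] supplied by p12 g6's ✓`cfgDistCauchyΦ_naturalCoherent_of_newLevel_of_fine` (below the new level the
(B)/(B′) letters are theorems at a coherent anchor): display ⇐ (43) kernel row · (K)[Φ♮] · (ℓ) · (k) · ∃ fine distance `δ` with (New) the two-run row of the record's `Bcfg` at the new
chart level (B0's coherence), (Lip♮) the old-level loop variable is `L_Φ(1+d)L^j·δ`-Lipschitz between the two fine backgrounds, (Fine_b) `δ(U_K, e₀(avg₀ U_{K+1})) ≤ C_f·θ(n)·(L^{−(K−n)})^b`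
(`2 ≤ b`, `a + 1 ≤ b`); (BC)'s constant is `max C_N (L_Φ·C_f)`.  THE NATURAL-OBJECT RESIDUE OF THE DECIDING CRUX (modulo T8, 2′χ(v4), `1 < L < M₁`) is then, letter for letter:
(43)-as-definition, p.263 L4 locality, the (43) kernel decay, (New), (Lip♮) — and THE TWO UNPRINTED two-run estimates (K)[Φ♮] (charts) and (Fine_b) (fine backgrounds) of
non-abelian `d = 3` (E2 = NO). [cite: Balaban1985UV3, p.263 L4, (25) p.262, (27)-(30) p.263, (33)-(34) p.264, (43)-(45) pp.266-267, (59)-(63) pp.270-272; King1986, Prop. 3.6 (3.56) p.662, Prop. 3.9 (3.71)-(3.74) p.665; Balaban1987RG1, (0.1) p.251] -/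
theorem k1aLegRowsDisplayTwoRunChiAtV4_of_kernelRowsSel_of_loc_ker_of_newLevel_fine {L : ℕ} (hL : 1 < L) {𝔠 : AlphaConsts L (suGroupModel 2).N} (hM : L < 𝔠.M₁) {a₀ a₁ a p₁ : ℝ}
    (ha₀ : 0 < a₀) (ha₁ : 0 < a₁) (hp₁ : 𝔠.p₀ + 𝔠.r₀ ≤ p₁)
    (hcoh : ∀ (F : T3Family) (K b : ℕ) (Y : Set (Site (F.P K) 0)), sel F (K + 1) (b + 1) (refineSet F K Y) = liftSite F K b (sel F K b Y))
    (h : ∃ (κ' R C C_A b L_Φ C_f C_N γB : ℝ), 0 < κ' ∧ 0 ≤ C ∧ 𝔠.C25 + 𝔠.C63 ≤ C_A ∧ 2 ≤ b ∧ a + 1 ≤ b ∧ 0 ≤ L_Φ ∧ 0 ≤ C_f ∧ 0 < γB ∧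
      ∀ (F : T3Family) (γ : ℝ) (hF : F.L = L) (hγ : 0 < γ), γ ≤ γB → ∀ (hγ1 : γ ≤ (min (hF ▸ 𝔠).gamma0 1) ^ 2),
        AlphaInputsT3AC.OfV4ChiAt F (hF ▸ 𝔠) a₀ a₁ →
          ∃ (p : ∀ K, AlphaInputsT3AC.PkgAtV4Chi F (hF ▸ 𝔠) γ hγ hγ1 K), (∀ K, (p K).a₀ = a₀ ∧ (p K).a₁ = a₁) ∧
            ∃ (N : (K b : ℕ) → Site (F.P K) (1 + b) → (n : ℕ) → (Fin n → PBond (F.P K) b) →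
                ContinuousMultilinearMap ℂ (fun _ : Fin n => ↥(lieC (suGroupModel 2))) ℂ),
              (∀ (K k : ℕ), k + 1 ≤ K → ∀ j : ℕ, j < k →
                ∀ y ∈ oldBlocks (hF ▸ 𝔠).lane.carrier.M₁ (rcolOf (SK F (hF ▸ 𝔠) γ hγ hγ1 K) (hF ▸ 𝔠).lane.carrier) (Hist.triv (F.P K) (k + 1)) (1 + j),
                  ∀ W : GaugeField (F.P K) (k + 1) (Matrix.specialUnitaryGroup (Fin 2) ℂ),
                    oldTermRows (fun K => (p K).toRows) K k (1 + j) y W =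
                      (∑ n ∈ Finset.Ico 2 7, ((n ! : ℂ))⁻¹ * ∑ c : Fin n → PBond (F.P K) j, N K j y n c (fun i =>
                        (fun K k b Y W c =>
                          if h : b + 1 = k then birthCfgAtRows (fun K => (p K).toRows) K b Y (h ▸ W) c
                          else if (l1 (rel (sel F K b Y) c.src) : ℝ) *
                              (2 * ((hF ▸ 𝔠).B₃ * θBal F.L γ (hF ▸ 𝔠).b₀ p₁ (K - k)) * (((F.L : ℝ) ^ (k - b))⁻¹) ^ 2) ≤ 1 / 2 then
                            (lieC (suGroupModel 2)).orthogonalProjectionOnto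
                              (vecE (suGroupModel 2).N
                                (B27T (unitsField (toUField (Averaging.iter (fun i => BlockAveraging.blockAvg (P := F.P K) (j := i) ℰp) b
                                  ((p K).UkH k (Hist.triv (F.P K) k) W)))) (sel F K b Y) c))
                          else 0) K (k + 1) j (blockSet K (1 + j) y) W (c i))).re) ∧
              FlatKernelLegCauchyΦ (AlphaInputsT3AC.dataOfV4chi p (canonPolymerRows fun K => (p K).toRows))
                (fun K b Y =>
                  if h : ∃ y : Site (F.P K) (1 + b), blockSet K (1 + b) y = Y then
                    (fun x : PBond (F.P K) b → ↥(lieC (suGroupModel 2)) =>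
                      ∑ n ∈ Finset.Ico 2 7, ((n ! : ℂ))⁻¹ * ∑ c : Fin n → PBond (F.P K) b, N K b h.choose n c (fun i => x (c i)))
                  else birthChartRows (fun K => (p K).toRows) K b Y)
                (canonLegDist F) κ' (hF ▸ 𝔠).κ a C ∧
              -- (ℓ) locality of the retained charts at leg distance `R`
              (∀ (K b : ℕ), b + 1 ≤ K → ∀ X ∈ newDomsRows (fun K => (p K).toRows) K b (Hist.triv (F.P K) (b + 1)),
                ∀ z : PBond (F.P K) b → ↥(lieC (suGroupModel 2)),
                  (((p K).toRows).𝔖 b).Ψ X z =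
                    (((p K).toRows).𝔖 b).Ψ X (fun c => if canonLegDist F K b (domSet (F := F) (hF ▸ 𝔠).lane.carrier.M₁ K b X) c ≤ R then z c else 0) ∧
                  (((p K).toRows).𝔄.Λc b).Ψ X z =
                    (((p K).toRows).𝔄.Λc b).Ψ X (fun c => if canonLegDist F K b (domSet (F := F) (hF ▸ 𝔠).lane.carrier.M₁ K b X) c ≤ R then z c else 0)) ∧
              -- (k) the (43) kernel budget at the listed blocks, radius `𝔠.ρ·e^{−κ′R}`
              (∀ (K k b : ℕ) (y : Site (F.P K) (1 + b)),
                blockSet K (1 + b) y ∈ canonLocRows (fun K => (p K).toRows) K k (Hist.triv (F.P K) k) (1 + b) →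
                  ∑ n ∈ Finset.Ico 2 7, ((n ! : ℝ))⁻¹ * ∑ c : Fin n → PBond (F.P K) b,
                    ‖N K b y n c‖ * (∏ i, Real.exp (κ' * canonLegDist F K b (blockSet K (1 + b) y) (c i))) *
                      ((hF ▸ 𝔠).ρ * Real.exp (-(κ' * R)) / 2) ^ n ≤
                    C_A * Real.exp (-(hF ▸ 𝔠).κ *
                      (AlphaInputsT3AC.dataOfV4chi p (canonPolymerRows fun K => (p K).toRows)).treeLen K (1 + b) (blockSet K (1 + b) y))) ∧
              -- a fine distance functional of the supplier's choosing
              ∃ δ : (K k : ℕ) → GaugeField (F.P K) 0 (Matrix.specialUnitaryGroup (Fin 2) ℂ) → GaugeField (F.P K) 0 (Matrix.specialUnitaryGroup (Fin 2) ℂ) → ℝ,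
              -- (New) the two-run row at the NEW chart level only (both sides are the record's `Bcfg`: B0's coherence)
              (∀ (K n : ℕ) (h : n ≤ K), ∀ j : ℕ, j < K - n → j + 1 = K - n → ∀ V : GaugeField (F.P n) 0 (Matrix.specialUnitaryGroup (Fin 2) ℂ), PlaqSmall (θBal F.L γ (hF ▸ 𝔠).b₀ p₁ n) V →
        ∀ Y ∈ (AlphaInputsT3AC.dataOfV4chi p (canonPolymerRows fun K => (p K).toRows)).Loc K (K - n)
          ((AlphaInputsT3AC.dataOfV4chi p (canonPolymerRows fun K => (p K).toRows)).triv K (K - n)) (1 + j), ∀ c : PBond (F.P K) j,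
          ‖(fun K k b Y W c =>
        if h : b + 1 = k then birthCfgAtRows (fun K => (p K).toRows) K b Y (h ▸ W) c
        else if (l1 (rel (sel F K b Y) c.src) : ℝ) * (2 * ((hF ▸ 𝔠).B₃ * θBal F.L γ (hF ▸ 𝔠).b₀ p₁ (K - k)) * (((F.L : ℝ) ^ (k - b))⁻¹) ^ 2) ≤ 1 / 2 then
          (lieC (suGroupModel 2)).orthogonalProjectionOnto (vecE (suGroupModel 2).N (B27T (unitsField (toUField
            (Averaging.iter (fun i => BlockAveraging.blockAvg (P := F.P K) (j := i) ℰp) b ((p K).UkH k (Hist.triv (F.P K) k) W)))) (sel F K b Y) c))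
        else 0) (K + 1) (K + 1 - n) (j + 1) (refineSet F K Y)
                (fieldShift (F.sitesPerDir_eq (m := F.m) (K := K + 1) (j := K + 1 - n) (m' := F.m) (K' := n) (j' := 0) (by omega)) V) (matchBond F K j c) -
              (fun K k b Y W c =>
        if h : b + 1 = k then birthCfgAtRows (fun K => (p K).toRows) K b Y (h ▸ W) c
        else if (l1 (rel (sel F K b Y) c.src) : ℝ) * (2 * ((hF ▸ 𝔠).B₃ * θBal F.L γ (hF ▸ 𝔠).b₀ p₁ (K - k)) * (((F.L : ℝ) ^ (k - b))⁻¹) ^ 2) ≤ 1 / 2 then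
          (lieC (suGroupModel 2)).orthogonalProjectionOnto (vecE (suGroupModel 2).N (B27T (unitsField (toUField
            (Averaging.iter (fun i => BlockAveraging.blockAvg (P := F.P K) (j := i) ℰp) b ((p K).UkH k (Hist.triv (F.P K) k) W)))) (sel F K b Y) c))
        else 0) K (K - n) j Y
                (fieldShift (F.sitesPerDir_eq (m := F.m) (K := K) (j := K - n) (m' := F.m) (K' := n) (j' := 0) (by omega)) V) c‖ ≤
            C_N * (1 + canonLegDist F K j Y c) * θBal F.L γ (hF ▸ 𝔠).b₀ p₁ n * (((F.L : ℝ) ^ (K - n - 1 - j))⁻¹) ^ 2 * (((F.L : ℝ) ^ (1 + j))⁻¹) ^ a) ∧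
              -- (Lip♮) Lipschitz of the old-level loop variable between the two fine backgrounds
              (∀ (K n : ℕ) (h : n ≤ K), ∀ j : ℕ, j + 1 < K - n → ∀ V : GaugeField (F.P n) 0 (Matrix.specialUnitaryGroup (Fin 2) ℂ), PlaqSmall (θBal F.L γ (hF ▸ 𝔠).b₀ p₁ n) V →
        ∀ Y ∈ (AlphaInputsT3AC.dataOfV4chi p (canonPolymerRows fun K => (p K).toRows)).Loc K (K - n)
          ((AlphaInputsT3AC.dataOfV4chi p (canonPolymerRows fun K => (p K).toRows)).triv K (K - n)) (1 + j), ∀ c : PBond (F.P K) j,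
          ‖(fun K k b Y (U : GaugeField (F.P K) 0 (Matrix.specialUnitaryGroup (Fin 2) ℂ)) c =>
        if (l1 (rel (sel F K b Y) c.src) : ℝ) * (2 * ((hF ▸ 𝔠).B₃ * θBal F.L γ (hF ▸ 𝔠).b₀ p₁ (K - k)) * (((F.L : ℝ) ^ (k - b))⁻¹) ^ 2) ≤ 1 / 2 then
          (lieC (suGroupModel 2)).orthogonalProjectionOnto (vecE (suGroupModel 2).N (B27T (unitsField (toUField
            (Averaging.iter (fun i => BlockAveraging.blockAvg (P := F.P K) (j := i) ℰp) b U))) (sel F K b Y) c))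
        else 0) K (K - n) j Y ((p K).UkH (K - n) (Hist.triv (F.P K) (K - n)) (fieldShift (F.sitesPerDir_eq (m := F.m) (K := K) (j := K - n) (m' := F.m) (K' := n) (j' := 0) (by omega)) V)) c -
            (fun K k b Y (U : GaugeField (F.P K) 0 (Matrix.specialUnitaryGroup (Fin 2) ℂ)) c =>
        if (l1 (rel (sel F K b Y) c.src) : ℝ) * (2 * ((hF ▸ 𝔠).B₃ * θBal F.L γ (hF ▸ 𝔠).b₀ p₁ (K - k)) * (((F.L : ℝ) ^ (k - b))⁻¹) ^ 2) ≤ 1 / 2 then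
          (lieC (suGroupModel 2)).orthogonalProjectionOnto (vecE (suGroupModel 2).N (B27T (unitsField (toUField
            (Averaging.iter (fun i => BlockAveraging.blockAvg (P := F.P K) (j := i) ℰp) b U))) (sel F K b Y) c))
        else 0) K (K - n) j Y
              (fieldShift (F.sitesPerDir_eq (m := F.m) (K := K) (j := 0) (m' := F.m) (K' := K + 1) (j' := 1) (by omega)) ((BlockAveraging.blockAvg (P := F.P (K + 1)) (j := 0) ℰp).avg
                ((p (K + 1)).UkH (K + 1 - n) (Hist.triv (F.P (K + 1)) (K + 1 - n)) (fieldShift (F.sitesPerDir_eq (m := F.m) (K := K + 1) (j := K + 1 - n) (m' := F.m) (K' := n) (j' := 0) (by omega)) V)))) c‖ ≤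
            L_Φ * (1 + canonLegDist F K j Y c) * (F.L : ℝ) ^ j *
              δ K (K - n) ((p K).UkH (K - n) (Hist.triv (F.P K) (K - n)) (fieldShift (F.sitesPerDir_eq (m := F.m) (K := K) (j := K - n) (m' := F.m) (K' := n) (j' := 0) (by omega)) V))
                (fieldShift (F.sitesPerDir_eq (m := F.m) (K := K) (j := 0) (m' := F.m) (K' := K + 1) (j' := 1) (by omega)) ((BlockAveraging.blockAvg (P := F.P (K + 1)) (j := 0) ℰp).avg
                ((p (K + 1)).UkH (K + 1 - n) (Hist.triv (F.P (K + 1)) (K + 1 - n)) (fieldShift (F.sitesPerDir_eq (m := F.m) (K := K + 1) (j := K + 1 - n) (m' := F.m) (K' := n) (j' := 0) (by omega)) V))))) ∧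
              -- (Fine_b) the two fine backgrounds of runs `K`, `K+1` are close in the supplier's fine distance `δ`
              (∀ (K n : ℕ) (h : n ≤ K), 1 < K - n → ∀ V : GaugeField (F.P n) 0 (Matrix.specialUnitaryGroup (Fin 2) ℂ), PlaqSmall (θBal F.L γ (hF ▸ 𝔠).b₀ p₁ n) V →
        δ K (K - n) ((p K).UkH (K - n) (Hist.triv (F.P K) (K - n)) (fieldShift (F.sitesPerDir_eq (m := F.m) (K := K) (j := K - n) (m' := F.m) (K' := n) (j' := 0) (by omega)) V))
            (fieldShift (F.sitesPerDir_eq (m := F.m) (K := K) (j := 0) (m' := F.m) (K' := K + 1) (j' := 1) (by omega)) ((BlockAveraging.blockAvg (P := F.P (K + 1)) (j := 0) ℰp).avg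
                ((p (K + 1)).UkH (K + 1 - n) (Hist.triv (F.P (K + 1)) (K + 1 - n)) (fieldShift (F.sitesPerDir_eq (m := F.m) (K := K + 1) (j := K + 1 - n) (m' := F.m) (K' := n) (j' := 0) (by omega)) V)))) ≤
          C_f * θBal F.L γ (hF ▸ 𝔠).b₀ p₁ n * (((F.L : ℝ) ^ (K - n))⁻¹) ^ b)) :
    K1aLegRowsDisplayTwoRunChiAtV4 L 𝔠 a₀ a₁ a p₁ := by
  obtain ⟨κ', R, C, C_A, b, L_Φ, C_f, C_N, γB, hκ', hC, hCA, hb2, hab, hLΦ, hCf, hγB, hall⟩ := h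
  have hCB : 0 ≤ max C_N (L_Φ * C_f) := le_max_of_le_right (mul_nonneg hLΦ hCf)
  refine k1aLegRowsDisplayTwoRunChiAtV4_of_kernelRowsSel_of_loc_ker sel hsel hL hM ha₀ ha₁ hp₁
    ⟨κ', R, C, C_A, max C_N (L_Φ * C_f), γB, hκ', hC, hCA, hCB, hγB, fun F γ hF hγ hγle hγ1 hOf => ?_⟩
  obtain ⟨p, hp, N, h43, hK, hloc, hker, δ, hNew, hLip, hFine⟩ := hall F γ hF hγ hγle hγ1 hOf
  subst hF
  exact ⟨p, hp, N, h43, hK, hloc, hker,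
    cfgDistCauchyΦ_naturalCoherent_of_newLevel_of_fine (fun K => (p K).toRows) p₁ (sel F) (hcoh F) δ (canonLegDist_nonneg F) hLΦ hCf hb2 hab
      hNew hLip hFine⟩

end Summit.QuantumFields.YangMills.Theorems.GlobalSlackKernelLeg

end
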